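import Literature.Probability.RandomPlanarGeometry.HexSAWPolygonCellsRoofEnd
import Literature.Probability.RandomPlanarGeometry.HexSAWPolygonCellsHostTransfer
import Literature.Probability.RandomPlanarGeometry.HexSAWPolygonCellsDiag
import HarnessLib

/-!
# Cell calculus for honeycomb polygon surgery, XXVI: the RU-family of bases — the chain `c_i = L^{2i} t₀`, its index, and the hosts of `B₀ + a_k`

Topic `Literature/Probability/RandomPlanarGeometry` (lane «pcv-sawmu», a-p4 g22; sequel of V `…CellsRoofEnd` (the roof-end spike), VII `…CellsHostTransfer`
(CLAIM H), VIII `…CellsDiag` (`diag`, host rows)).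

The third base type of «OMEGA» (`HOME/pub-sawmu-a-p4/g21/omega/THEOREM-OMEGA-g21.md` §2, RU-family): `B = B₀ + a_k` where `B₀` is of type R at its top `t₀`
(`L t₀ ∉ B₀`, run `e_0..e_{k−1} ⊆ B₀`, `e_k ∉ B₀`, `k ≥ 2`) and `a_k = roofCell t₀ (k−1) = UR e_{k−1}` is a spike.  This file fixes the vocabulary:
* `chainCell t₀ i = (t₀.x − 4i, t₀.y)` (`c_i = L^{2i} t₀`), `ChainStop B₀ t₀ i :↔ L c_i ∈ B₀ ∨ L² c_i ∉ B₀`, `exists_chainStop`, the CHAIN INDEX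
  `chainIdx B₀ t₀ = min {i | ChainStop}` (`Nat.find`) with `chainStop_chainIdx`, `not_chainStop_of_lt`, `chainCell_mem` (`c_i ∈ B₀` for `i ≤ j`),
  `chainCell_isHost` (each `c_i`, `i ≤ j`, is a host of `B₀`);
* `mem_topRow_right_of_chain` — a hexagon of `B₀` on the top row strictly right of `c_j` is a `c_i`, `i < j`;
* `topRow_host_left_le` — a top-row host left of `c_j` has abscissa `≤ c_j.x − 6`;
* `isSpikeTop_roofEnd` (`a_k` is a spike top of `B`) and ★ `isHost_roofEnd_iff` — the hosts of `B`: `a_k`, the top-row hosts of `B₀`, and the second-row hosts of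
  `B₀` at abscissa `≥ t₀.x + 2k + 3` (CLAIM H + VIII `IsHost.lowRow_ge_of_run`).

Sources: N. Madras, G. Slade, *The Self-Avoiding Walk* (1993), §3.2, proof of Theorem 3.2.3 [MadrasSlade1993]; I. Jensen, J. Phys.: Conf. Ser. 42 (2006) 163
[Jensen2006HoneycombPolygons].  Label (lane): LANE INFRASTRUCTURE for the lane's step-two injection; nothing new in writing beyond the lane result.
-/

open Finset

namespace Literature.Probability.RandomPlanarGeometry.SAW

namespace HexCell

/-! ### The chain -/

/-- `c_i = L^{2i} t₀ = (t₀.x − 4 i, t₀.y)`. [cite: MadrasSlade1993, §3.2 (proof of Theorem 3.2.3)] -/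
def chainCell (t₀ : Cell) (i : ℕ) : Cell := (t₀.1 - 4 * (i : ℤ), t₀.2)

/-- [cite: MadrasSlade1993, §3.2 (proof of Theorem 3.2.3)] -/
@[simp] theorem chainCell_fst (t₀ : Cell) (i : ℕ) : (chainCell t₀ i).1 = t₀.1 - 4 * (i : ℤ) := rfl

/-- [cite: MadrasSlade1993, §3.2 (proof of Theorem 3.2.3)] -/
@[simp] theorem chainCell_snd (t₀ : Cell) (i : ℕ) : (chainCell t₀ i).2 = t₀.2 := rfl

/-- `c_0 = t₀`. [cite: MadrasSlade1993, §3.2 (proof of Theorem 3.2.3)] -/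
@[simp] theorem chainCell_zero (t₀ : Cell) : chainCell t₀ 0 = t₀ := by ext <;> simp

/-- `c_{i+1} = L (L c_i)`. [cite: MadrasSlade1993, §3.2 (proof of Theorem 3.2.3)] -/
theorem chainCell_succ (t₀ : Cell) (i : ℕ) : chainCell t₀ (i + 1) = L (L (chainCell t₀ i)) :=
  Prod.ext (by simp only [chainCell_fst, L_fst]; push_cast; ring) (by simp)

/-- The chain index is injective. [cite: MadrasSlade1993, §3.2 (proof of Theorem 3.2.3)] -/
theorem chainCell_injective (t₀ : Cell) : Function.Injective (chainCell t₀) := by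
  intro i i' h; have := congrArg Prod.fst h; simp at this; omega

/-- The stopping condition of the chain at `c_i`: its left neighbour is present (→ flip) or the next chain hexagon is absent (→ leaf).
[cite: MadrasSlade1993, §3.2 (proof of Theorem 3.2.3)] -/
def ChainStop (B₀ : Finset Cell) (t₀ : Cell) (i : ℕ) : Prop := L (chainCell t₀ i) ∈ B₀ ∨ L (L (chainCell t₀ i)) ∉ B₀

/-- The chain stops (the set is finite). [cite: MadrasSlade1993, §3.2 (proof of Theorem 3.2.3)] -/
theorem exists_chainStop (B₀ : Finset Cell) (t₀ : Cell) : ∃ i, ChainStop B₀ t₀ i := by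
  classical
  by_contra h
  push Not at h
  -- then `c_i ∈ B₀` for all `i ≥ 1`, an injective sequence in a finite set
  have hmem : ∀ i, chainCell t₀ (i + 1) ∈ B₀ := fun i => by
    have := h i; rw [ChainStop, not_or, not_not] at this; rw [chainCell_succ]; exact this.2
  have hinj : Set.InjOn (fun i : ℕ => chainCell t₀ (i + 1)) (Set.univ : Set ℕ) := fun i _ i' _ e => by
    have := chainCell_injective t₀ e; omega
  have hfin := Set.Finite.of_finite_image ((B₀ : Set Cell).toFinite.subset (by rintro _ ⟨i, -, rfl⟩; exact hmem i)) hinj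
  exact Set.infinite_univ hfin

open Classical in
/-- **The chain index** `j`: the least `i` with `ChainStop B₀ t₀ i`. [cite: MadrasSlade1993, §3.2 (proof of Theorem 3.2.3)] -/
noncomputable def chainIdx (B₀ : Finset Cell) (t₀ : Cell) : ℕ := Nat.find (exists_chainStop B₀ t₀)

open Classical in
/-- The chain stops at `j`. [cite: MadrasSlade1993, §3.2 (proof of Theorem 3.2.3)] -/
theorem chainStop_chainIdx (B₀ : Finset Cell) (t₀ : Cell) : ChainStop B₀ t₀ (chainIdx B₀ t₀) := Nat.find_spec (exists_chainStop B₀ t₀)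

open Classical in
/-- Before `j` the chain does not stop: `L c_i ∉ B₀` and `c_{i+1} ∈ B₀`. [cite: MadrasSlade1993, §3.2 (proof of Theorem 3.2.3)] -/
theorem not_chainStop_of_lt {B₀ : Finset Cell} {t₀ : Cell} {i : ℕ} (hi : i < chainIdx B₀ t₀) :
    L (chainCell t₀ i) ∉ B₀ ∧ chainCell t₀ (i + 1) ∈ B₀ := by
  have := Nat.find_min (exists_chainStop B₀ t₀) hi
  rw [ChainStop, not_or, not_not] at this
  rw [chainCell_succ]; exact this

/-- `c_i ∈ B₀` for `i ≤ j` (given `t₀ ∈ B₀`). [cite: MadrasSlade1993, §3.2 (proof of Theorem 3.2.3)] -/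
theorem chainCell_mem {B₀ : Finset Cell} {t₀ : Cell} (ht₀ : t₀ ∈ B₀) {i : ℕ} (hi : i ≤ chainIdx B₀ t₀) : chainCell t₀ i ∈ B₀ := by
  rcases Nat.eq_zero_or_pos i with rfl | hpos
  · simpa using ht₀
  · obtain ⟨i', rfl⟩ : ∃ i', i = i' + 1 := ⟨i - 1, by omega⟩
    exact (not_chainStop_of_lt (by omega)).2

/-- A hexagon of `B₀` on the top row strictly right of `c_j` (and left of `t₀`) is a chain hexagon `c_i`, `i < j`.
[cite: MadrasSlade1993, §3.2 (proof of Theorem 3.2.3)] -/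
theorem mem_topRow_right_of_chain {B₀ : Finset Cell} {t₀ : Cell} (hB : IsBrickSet B₀) (ht : IsLexmax B₀ t₀) {d : Cell} (hd : d ∈ B₀) (hrow : d.2 = t₀.2)
    (hx : (chainCell t₀ (chainIdx B₀ t₀)).1 < d.1) : ∃ i < chainIdx B₀ t₀, d = chainCell t₀ i := by
  have hle : d.1 ≤ t₀.1 := by rcases ht.2 d hd with h1 | ⟨-, h1⟩ <;> omega
  obtain ⟨m, hm⟩ := hB d hd
  obtain ⟨m₀, hm₀⟩ := hB t₀ ht.1
  simp only [chainCell_fst] at hx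
  -- `t₀.x − d.x = 2n` with `0 ≤ n < 2j`
  obtain ⟨n, hn⟩ : ∃ n : ℕ, t₀.1 - d.1 = 2 * (n : ℤ) := ⟨((t₀.1 - d.1) / 2).toNat, by omega⟩
  rcases Nat.even_or_odd n with ⟨i, hi⟩ | ⟨i, hi⟩
  · refine ⟨i, by omega, ?_⟩
    ext <;> simp <;> omega
  · -- odd: `d = L c_i` with `i < j`, absent
    exfalso
    have hlt : i < chainIdx B₀ t₀ := by omega
    have e : d = L (chainCell t₀ i) := by ext <;> simp <;> omega
    exact (not_chainStop_of_lt hlt).1 (e ▸ hd)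

/-- Each chain hexagon `c_i`, `i ≤ j`, is a top-row host of `B₀` (`R c_i ∉ B₀`; for `i = 0` because `R t₀ = a_1 ∉ B₀`).
[cite: MadrasSlade1993, §3.2 (proof of Theorem 3.2.3)] -/
theorem chainCell_isHost {B₀ : Finset Cell} {t₀ : Cell} (ht : IsLexmax B₀ t₀) {i : ℕ} (hi : i ≤ chainIdx B₀ t₀) :
    IsHost B₀ (chainCell t₀ i) := by
  refine ⟨chainCell_mem ht.1 hi, ?_, ?_, ?_⟩
  · rcases Nat.eq_zero_or_pos i with rfl | hpos
    · rw [chainCell_zero]; exact ht.r_notMem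
    · obtain ⟨i', rfl⟩ : ∃ i', i = i' + 1 := ⟨i - 1, by omega⟩
      have e : R (chainCell t₀ (i' + 1)) = L (chainCell t₀ i') := Prod.ext (by simp only [R_fst, L_fst, chainCell_fst]; push_cast; ring) (by simp)
      rw [e]; exact (not_chainStop_of_lt (by omega)).1
  · exact ht.notMem_of_row_lt (by simp)
  · intro c hc
    rcases ht.2 c hc with h1 | ⟨h1, h2⟩
    · left; simp; omega
    · rcases lt_or_eq_of_le h2 with h3 | h3
      · left; simp; omega  -- wait: c on top row: c.2 = t₀.2 = (c_i).2 < (c_i).2 + 1 ✓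
      · left; simp; omega

/-- A top-row host of `B₀` left of `c_j` has abscissa `≤ c_j.x − 6`. [cite: MadrasSlade1993, §3.2 (proof of Theorem 3.2.3)] -/
theorem topRow_host_left_le {B₀ : Finset Cell} {t₀ : Cell} (hB : IsBrickSet B₀) (ht : IsLexmax B₀ t₀) {d : Cell} (hd : IsHost B₀ d)
    (hrow : d.2 = t₀.2) (hx : d.1 < (chainCell t₀ (chainIdx B₀ t₀)).1) : d.1 ≤ (chainCell t₀ (chainIdx B₀ t₀)).1 - 6 := by
  set j := chainIdx B₀ t₀
  obtain ⟨m, hm⟩ := hB d hd.1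
  obtain ⟨m₀, hm₀⟩ := hB t₀ ht.1
  simp only [chainCell_fst] at hx ⊢
  -- `d.x ≡ t₀.x (mod 2)`; exclude `d.x = c_j.x − 2` and `d.x = c_j.x − 4`
  have h2 : d.1 ≠ t₀.1 - 4 * j - 2 := by
    intro e
    -- then `d = L c_j` and `R d = c_j ∈ B₀`: not a host
    apply hd.2.1
    have : R d = chainCell t₀ j := by ext <;> simp <;> omega
    rw [this]; exact chainCell_mem ht.1 le_rfl
  have h4 : d.1 ≠ t₀.1 - 4 * j - 4 := by
    intro e
    -- then `d = L² c_j`; by `ChainStop j`: either `L c_j ∈ B₀` (= `R d`, so `d` is no host) or `L² c_j ∉ B₀` (= `d`)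
    have ed : d = L (L (chainCell t₀ j)) := by ext <;> simp <;> omega
    rcases chainStop_chainIdx B₀ t₀ with h | h
    · apply hd.2.1
      have : R d = L (chainCell t₀ j) := by ext <;> simp <;> omega
      rw [this]; exact h
    · exact h (ed ▸ hd.1)
  omega

/-! ### The roof-end base `B = B₀ + a_k` and its hosts -/

/-- The spike `a_k = roofCell t₀ (k−1)` is a spike top of `B = B₀ + a_k`. [cite: MadrasSlade1993, §3.2 (proof of Theorem 3.2.3)] -/
theorem isSpikeTop_roofEnd {B₀ : Finset Cell} {t₀ : Cell} (ht : IsLexmax B₀ t₀) {k : ℕ} (hk : 2 ≤ k) (hrun : ∀ i < k, runCell t₀ i ∈ B₀)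
    (hend : runCell t₀ k ∉ B₀) : IsSpikeTop (insert (roofCell t₀ (k - 1)) B₀) (roofCell t₀ (k - 1)) := by
  classical
  obtain ⟨hnot, hone⟩ := card_contacts_roofCell_last ht hk hrun hend
  refine ⟨⟨mem_insert_self _ _, fun c hc => ?_⟩, ?_⟩
  · rcases mem_insert.1 hc with rfl | hc
    · right; exact ⟨rfl, le_rfl⟩
    · rcases ht.2 c hc with h1 | ⟨h1, h2⟩
      · left; simpa using h1
      · right; simp only [roofCell_fst, roofCell_snd]; exact ⟨by omega, by omega⟩
  · -- contacts in `B`: those in `B₀` (one, namely `e_{k−1} = LL a_k`) — `a_k` is not its own neighbour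
    have hself : nbrs (roofCell t₀ (k - 1)) ∩ insert (roofCell t₀ (k - 1)) B₀ = nbrs (roofCell t₀ (k - 1)) ∩ B₀ := by
      rw [insert_eq, inter_union_distrib_left, inter_singleton_of_notMem (self_notMem_nbrs _), empty_union]
    rw [hself]
    obtain ⟨d, hd⟩ := card_eq_one.1 hone
    have hll : LL (roofCell t₀ (k - 1)) ∈ nbrs (roofCell t₀ (k - 1)) ∩ B₀ := by
      refine mem_inter.2 ⟨by rw [mem_nbrs_iff]; simp [LL], ?_⟩
      have e : LL (roofCell t₀ (k - 1)) = runCell t₀ (k - 1) :=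
        Prod.ext (show t₀.1 + 2 * ((k - 1 : ℕ) : ℤ) + 2 - 1 = t₀.1 + 2 * ((k - 1 : ℕ) : ℤ) + 1 by omega) rfl
      rw [e]; exact hrun _ (by omega)
    rw [hd] at hll ⊢
    rw [mem_singleton] at hll
    rw [hll]

/-- ★ **The hosts of the roof-end base** `B = B₀ + a_k`: `a_k` itself, the top-row hosts of `B₀`, and the second-row hosts of `B₀` right of the run
(abscissa `≥ t₀.x + 2k + 3`). [cite: MadrasSlade1993, §3.2 (proof of Theorem 3.2.3)] -/
theorem isHost_roofEnd_iff {B₀ : Finset Cell} {t₀ : Cell} (hB : IsBrickSet B₀) (ht : IsLexmax B₀ t₀) {k : ℕ} (hk : 2 ≤ k)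
    (hrun : ∀ i < k, runCell t₀ i ∈ B₀) (hend : runCell t₀ k ∉ B₀) {d : Cell} :
    IsHost (insert (roofCell t₀ (k - 1)) B₀) d ↔
      d = roofCell t₀ (k - 1) ∨ (IsHost B₀ d ∧ d.2 = t₀.2) ∨ (IsHost B₀ d ∧ d.2 = t₀.2 - 1 ∧ t₀.1 + 2 * k + 3 ≤ d.1) := by
  have hsp := isSpikeTop_roofEnd ht hk hrun hend
  by_cases hda : d = roofCell t₀ (k - 1)
  · subst hda; simp only [true_or, iff_true]; exact hsp.isHost
  rw [isHost_iff_isHost_erase hsp hda, erase_insert (ht.roofCell_notMem _)]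
  simp only [hda, false_or, roofCell_fst, roofCell_snd]
  constructor
  · rintro ⟨hd, hpos⟩
    rcases hd.row_cases hB ht with ⟨hrow, -, -⟩ | ⟨hrow, -⟩
    · exact Or.inl ⟨hd, hrow⟩
    · right; refine ⟨hd, hrow, ?_⟩
      have hne : ∀ i < k, d ≠ runCell t₀ i := by
        intro i hi e; subst e; simp only [runCell_fst, runCell_snd] at hpos; omega
      exact hd.lowRow_ge_of_run hB ht hrun hend hrow hne
  · rintro (⟨hd, hrow⟩ | ⟨hd, hrow, hx⟩)
    · exact ⟨hd, Or.inl (by omega)⟩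
    · exact ⟨hd, Or.inr ⟨by omega, by omega⟩⟩

/-! ### Diagonal gaps between hosts; the top-row dichotomy -/

variable {B₀ : Finset Cell} {t₀ : Cell} {k : ℕ} in
/-- Distinct hosts of the roof-end base lie on diagonals `≥ 4` apart. [cite: MadrasSlade1993, §3.2 (proof of Theorem 3.2.3)] -/
theorem hosts_diag_gap_roofEnd (hB : IsBrickSet B₀) (ht : IsLexmax B₀ t₀) (hk : 2 ≤ k) (hrun : ∀ i < k, runCell t₀ i ∈ B₀) (hend : runCell t₀ k ∉ B₀)
    {h h' : Cell} (hh : IsHost (insert (roofCell t₀ (k - 1)) B₀) h) (hh' : IsHost (insert (roofCell t₀ (k - 1)) B₀) h') (hne : h ≠ h') :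
    4 ≤ |diag h - diag h'| := by
  have H := isHost_roofEnd_iff hB ht hk hrun hend (d := h)
  have H' := isHost_roofEnd_iff hB ht hk hrun hend (d := h')
  have hk1 : (1 : ℤ) ≤ ((k - 1 : ℕ) : ℤ) := by exact_mod_cast (show 1 ≤ k - 1 by omega)
  rw [le_abs]
  simp only [diag]
  rcases H.1 hh with rfl | ⟨hd, hrow⟩ | ⟨hd, hrow, hx⟩ <;> rcases H'.1 hh' with rfl | ⟨hd', hrow'⟩ | ⟨hd', hrow', hx'⟩
  · exact absurd rfl hne
  · have := ht.2 _ hd'.1; simp only [roofCell_fst, roofCell_snd]; omega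
  · simp only [roofCell_fst, roofCell_snd]; omega
  · have := ht.2 _ hd.1; simp only [roofCell_fst, roofCell_snd]; omega
  · have := hd.sameRow_gap hB hd' (by omega) hne; rw [le_abs] at this; omega
  · have := ht.2 _ hd.1; omega
  · simp only [roofCell_fst, roofCell_snd]; omega
  · have := ht.2 _ hd'.1; omega
  · have := hd.sameRow_gap hB hd' (by omega) hne; rw [le_abs] at this; omega

variable {B₀ : Finset Cell} {t₀ : Cell} in
/-- A top-row host of `B₀` other than `c_j`: either a chain hexagon `c_i` (`i < j`) to the right, or `≥ 6` to the left of `c_j`.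
[cite: MadrasSlade1993, §3.2 (proof of Theorem 3.2.3)] -/
theorem topRow_host_dichotomy (hB : IsBrickSet B₀) (ht : IsLexmax B₀ t₀) {d : Cell} (hd : IsHost B₀ d) (hrow : d.2 = t₀.2)
    (hne : d ≠ chainCell t₀ (chainIdx B₀ t₀)) :
    (∃ i < chainIdx B₀ t₀, d = chainCell t₀ i) ∨ d.1 ≤ (chainCell t₀ (chainIdx B₀ t₀)).1 - 6 := by
  rcases lt_trichotomy d.1 (chainCell t₀ (chainIdx B₀ t₀)).1 with h | h | h
  · exact Or.inr (topRow_host_left_le hB ht hd hrow h)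
  · exact absurd (Prod.ext h (by rw [hrow, chainCell_snd])) hne
  · exact Or.inl (mem_topRow_right_of_chain hB ht hd.1 hrow h)

end HexCell

end Literature.Probability.RandomPlanarGeometry.SAW
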